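import Summits.CriticalPhenomena.PercolationContinuityZ3.Theorems.PercNearOneGluingNoHeavyLowerTailMajorityGluingQCert3Slice
import HarnessLib

/-!
# Slice evaluator soundness, part 1: the partition identity for linear-form terms (lane prim-rate, constants-miner 1, gen 34; NEXT-g35 item 0)

Support file for the closed crux `NoHeavyLowerTail` (stmt-CriticalPhenomena-4575), majority-gluing line; companion of `…QCert3Slice`.  `sum_suppGe` (sums over
`suppGe N lo P` as restricted sums over `Finset.Ico lo N`) and **`sum_linSlice`**: for `a, b < N`, summing `evalC val (linSlice N i₀ F a b z)` over the smallest index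
`i₀ < N` gives the full term `evalC val ((suppOf N F).map fun i => (key3 N i a b, z))` — each contribution `(i, a, b)` lies in exactly the slice `min i (min a b)`.
The product analogue (`sum_prodSlice`) and the assembly over `Cert3.contribs` are NEXT-g35 item 0.  No sorries.
-/

namespace Summit.CriticalPhenomena.PercolationContinuityZ3.Theorems

namespace HubOnly
namespace QCert

noncomputable section

/-- A sum over `range' lo d` filtered by `P` is the restricted sum over `Finset.Ico lo (lo + d)`. -/
theorem sum_range'_filter (lo : ℕ) (P : ℕ → Bool) (f : ℕ → ℝ) :
    ∀ d : ℕ, (((List.range' lo d).filter P).map f).sum = ∑ i ∈ Finset.Ico lo (lo + d), (if P i then f i else 0)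
  | 0 => by simp
  | d + 1 => by
    rw [List.range'_concat, List.filter_append, List.map_append, List.sum_append, sum_range'_filter lo P f d, ← Nat.add_assoc,
      Finset.sum_Ico_succ_top (by omega)]
    congr 1
    by_cases hP : P (lo + d) = true
    · simp [hP]
    · simp [hP]

/-- A sum over `suppGe N lo P` is the restricted sum over `Finset.Ico lo N`. -/
theorem sum_suppGe (N lo : ℕ) (P : ℕ → Bool) (f : ℕ → ℝ) :
    ((suppGe N lo P).map f).sum = ∑ i ∈ Finset.Ico lo N, (if P i then f i else 0) := by
  unfold suppGe
  by_cases hlo : lo ≤ N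
  · obtain ⟨d, rfl⟩ := Nat.exists_eq_add_of_le hlo
    rw [Nat.add_sub_cancel_left, sum_range'_filter]
  · have h0 : N - lo = 0 := by omega
    rw [h0, List.range'_zero, Finset.Ico_eq_empty (by omega)]
    simp

/-- The value of a linear slice, by cases on the position of `i₀` relative to `min a b`. -/
theorem evalC_linSlice (N i₀ : ℕ) (F : ℕ → Bool) (a b : ℕ) (z : ℤ) (val : ℕ → ℝ) :
    evalC val (linSlice N i₀ F a b z) =
      if min a b < i₀ then 0
      else if min a b = i₀ then ∑ i ∈ Finset.Ico i₀ N, (if F i then (z : ℝ) * val (key3 N i a b) else 0)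
      else (if F i₀ then (z : ℝ) * val (key3 N i₀ a b) else 0) := by
  unfold linSlice
  by_cases h1 : a < i₀ ∨ b < i₀
  · have hm : min a b < i₀ := by omega
    rw [if_pos h1, if_pos hm]; simp [evalC]
  · have hm : ¬ min a b < i₀ := by omega
    rw [if_neg h1, if_neg hm]
    by_cases h2 : a = i₀ ∨ b = i₀
    · have hm2 : min a b = i₀ := by omega
      rw [if_pos h2, if_pos hm2, evalC_map, sum_suppGe]
    · have hm2 : ¬ min a b = i₀ := by omega
      rw [if_neg h2, if_neg hm2]
      by_cases hF : F i₀ = true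
      · rw [if_pos hF, if_pos hF]; simp [evalC]
      · rw [if_neg hF, if_neg hF]; simp [evalC]

/-- **Partition identity for linear-form terms:** summing the slices over the smallest index recovers the full term (for `a, b < N`). -/
theorem sum_linSlice (N : ℕ) (F : ℕ → Bool) (a b : ℕ) (z : ℤ) (ha : a < N) (hb : b < N) (val : ℕ → ℝ) :
    ∑ i₀ ∈ Finset.range N, evalC val (linSlice N i₀ F a b z) = evalC val ((suppOf N F).map fun i => (key3 N i a b, z)) := by
  set m := min a b with hm
  have hmN : m < N := by omega
  set S : ℕ → ℝ := fun i => if F i then (z : ℝ) * val (key3 N i a b) else 0 with hS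
  have hR : evalC val ((suppOf N F).map fun i => (key3 N i a b, z)) = ∑ i ∈ Finset.range N, S i := by
    rw [evalC_map, sum_suppOf]
  rw [hR]
  have hL : ∀ i₀, evalC val (linSlice N i₀ F a b z) =
      if m < i₀ then 0 else if m = i₀ then ∑ i ∈ Finset.Ico i₀ N, S i else S i₀ := fun i₀ => evalC_linSlice N i₀ F a b z val
  simp_rw [hL]
  rw [Finset.range_eq_Ico, ← Finset.sum_Ico_consecutive _ (Nat.zero_le m) hmN.le, Finset.sum_eq_sum_Ico_succ_bot hmN]
  have hlow : ∑ i₀ ∈ Finset.Ico 0 m, (if m < i₀ then (0 : ℝ) else if m = i₀ then ∑ i ∈ Finset.Ico i₀ N, S i else S i₀) =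
      ∑ i₀ ∈ Finset.Ico 0 m, S i₀ := by
    refine Finset.sum_congr rfl fun i₀ hi₀ => ?_
    rw [Finset.mem_Ico] at hi₀
    rw [if_neg (by omega), if_neg (by omega)]
  have hmid : (if m < m then (0 : ℝ) else if m = m then ∑ i ∈ Finset.Ico m N, S i else S m) = ∑ i ∈ Finset.Ico m N, S i := by
    rw [if_neg (lt_irrefl m), if_pos rfl]
  have hhigh : ∑ i₀ ∈ Finset.Ico (m + 1) N, (if m < i₀ then (0 : ℝ) else if m = i₀ then ∑ i ∈ Finset.Ico i₀ N, S i else S i₀) = 0 := by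
    refine Finset.sum_eq_zero fun i₀ hi₀ => ?_
    rw [Finset.mem_Ico] at hi₀
    rw [if_pos (by omega)]
  rw [hlow, hmid, hhigh, add_zero, Finset.sum_Ico_consecutive _ (Nat.zero_le m) hmN.le]

end

end QCert
end HubOnly

end Summit.CriticalPhenomena.PercolationContinuityZ3.Theorems
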